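import Literature.MathematicalPhysics.QuantumFieldTheory.Balaban1983to89.QGQInverse

/-!
# King 1986, Lemma 4.5: the `L^{-k}` rate of the unit-lattice fluctuation covariance `C^{(k)}`
# by resolvent interpolation — (4.32)–(4.34), (4.38)–(4.41)

**Citation header (reproduction of PUBLISHED work; template file of the Bałaban lattice Yang–Mills cell
`pub-balaban`, TEMPLATE.md §18 (K5); companion of `King1986/EffectiveLaplacianRate`, `…/AliasingIdentity`,
`…/CompositionRate`, `…/CompositionLaw`).**
C. King, *The U(1) Higgs model. I. The continuum limit*, Commun. Math. Phys. **102** (1986) 649–677 [King1986],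
§4 "Technical Estimates", pp. 674–675: the interpolating covariance (4.32), the decay conditions (4.33)–(4.34), and
Lemma 4.5 (4.38) with its proof (4.39)–(4.41).  Every formula quoted below was read on page images of the Euclid scan
(cell folder `b2b-balaban-template/king-renders/1986-cmp102-king-u1-higgs-I-p026-x2.png`, `…-p027-x2.png`); the OCR
text layer of that scan is unusable for formulas.  King's paper is TEMPLATE LITERATURE for the cell (a printed and
proved `A = 0` mechanism), not one of the manuscripts under audit.

**What King prints (verbatim, pp. 674–675).**  *"We also need convergence properties of the operator C^{(k)} defined
in (2.16). Introduce the operator  C_Ω^{(k)}(s) = (sΔ^{(k)} + (1−s)Δ^{(k+n)} + aL^{−2}Q*Q)^{−1}, (4.32)  where 0 ≤ s ≤ 1,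
Ω ⊂ Z^d is a rectangular parallelepiped composed of blocks of L^d sites, and where Δ^{(k)}, Δ^{(k+n)} are defined with
periodic boundary conditions on Ω. Using the general results of Chap. 5 of [Ba 4], C_Ω^{(k)}(s) has uniform exponential
decay if the following conditions hold: (i) C_Ω^{(k)}(s)^{−1} ≥ γ₀I, (4.33) (ii) |C_Ω^{(k)}(s)^{−1}(x, y)| ≤
C exp[−δ₀|x−y|]. (4.34)  The condition (4.34) is immediate, since Q*Q is a short-range operator and Δ^{(k)} has
uniform exponential decay (see Theorem 3.3). To prove (4.33), we use a Fourier representation on Ω."* [(4.35)–(4.37):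
`⟨φ,(sΔ^{(k)} + (1−s)Δ^{(k+n)} + aL^{−2}Q*Q)φ⟩ ≥ … ≥ C⟨φ,φ⟩`] *"… as required. We now prove the required convergence
properties of C^{(k)}.*  **Lemma 4.5.** *|C^{(k)}(x, y) − C^{(k+n)}(x, y)| ≤ CL^{−k}e^{−δ₀|x−y|}. (4.38)  Proof. We prove
(4.38) in a finite volume Ω with periodic boundary conditions; the result for free boundary conditions then holds by
continuity. First,  C^{(k)}(x, y) − C^{(k+n)}(x, y) = ∫₀¹ ds d/ds C_Ω^{(k)}(s)(x, y) = 1/2 ∫₀¹ ds · {⟨φ(x)φ(y);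
Σ_{z,w∈Ω} φ(z)[Δ^{(k+n)}(z, w) − Δ^{(k)}(z, w)]φ(w)⟩_s}, (4.39)  where the expectation ⟨·⟩_s is taken with respect to
the covariance C_Ω^{(k)}(s). Explicit computation gives  Σ_{z,w∈Ω} {C_Ω^{(k)}(s)(x, z)[Δ^{(k+n)}(z, w) − Δ^{(k)}(z, w)]
C_Ω^{(k)}(s)(w, y)}. (4.40)  Combining Lemma 4.3 and the uniform exponential decay of Δ^{(k)} and C_Ω^{(k)}(s) gives
|(4.40)| ≤ CL^{−k} Σ_{z,w∈Ω} exp[−δ₀|x−z| − δ₀|z−w| − δ₀|w−y|] ≤ CL^{−k} exp[−δ₀|x−y|]. (4.41)"*  (Here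
[Ba 4] = T. Bałaban, *Regularity and decay of lattice Green's functions*, Commun. Math. Phys. **89** (1983) 571–597
[Balaban1983RegularityDecay]; Lemma 4.3 = (4.18) p. 672, `|Δ^{(k)}(p) − Δ^{(k+n)}(p)| ≤ CL^{−2k}|Δ^{(k)}(p)|`, kernel
`King1986.lemma43_aK` of `…/CompositionLaw`.)

**What this file PROVES (kernel; finite index set `n` = the sites of Ω, real matrices, an abstract pseudo-metric `d`
in place of `|x − y|` on the torus).**  Writing `Δ₁ := Δ^{(k)}`, `Δ₀ := Δ^{(k+n)}`, `B := aL⁻²Q*Q`: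
* §1 `interpOp`/`covOp` = (4.32); the resolvent identity `inv_sub_inv_of_isUnit` and the EXACT difference form of
  (4.39)–(4.40), `covOp_sub_covOp`: `C(t) − C(s) = (t − s)·C(t)[Δ^{(k+n)} − Δ^{(k)}]C(s)`; at the endpoints
  `covOp_one_sub_covOp_zero`: `C^{(k)} − C^{(k+n)} = C^{(k)}[Δ^{(k+n)} − Δ^{(k)}]C^{(k+n)}`.
* §2 (4.33) ALONG THE SEGMENT FROM ITS ENDPOINTS (`coercive_interpOp`: the quadratic form of `C(s)⁻¹` is the convex
  combination of the two endpoint forms, `form_interpOp`), hence `C(s)⁻¹` is a unit and `|C(s)(x,y)| ≤ γ₀⁻¹` for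
  `0 ≤ s ≤ 1` (`isUnit_interpOp`, `abs_covOp_apply_le_inv`, from the tree's `QGQInverse.isUnit_of_coercive`,
  `QGQInverse.inv_entry_le_of_coercive`).
* §4 KING'S ROUTE AS PRINTED: every entry of `C(s)` is Lipschitz on `[0,1]` (`abs_covOp_sub_covOp_le`), the
  derivative `(d/ds)C(s)(x,y) = (C(s)[Δ^{(k+n)} − Δ^{(k)}]C(s))(x,y)` = (4.40) for `0 < s < 1`
  (`hasDerivAt_covOp_apply`, from the difference form and continuity — we differentiate the matrix inverse directly;
  King's intermediate Gaussian truncated expectation `1/2⟨φ(x)φ(y); …⟩_s` is not formalised), and the integral formula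
  (4.39) `C^{(k)}(x,y) − C^{(k+n)}(x,y) = ∫₀¹ ds (4.40)` (`covOp_one_sub_zero_eq_integral`, fundamental theorem of
  calculus).
* §5 THE "CHAP. 5 OF [Ba 4]" STEP in finite volume: (4.33) at the endpoints + (4.34) in the summable form the finite
  Combes–Thomas lemma consumes (weighted off-diagonal row/column sums `Σ_j |M(i,j)|(e^{κd(i,j)} − 1)` of `Δ^{(k)}`,
  `Δ^{(k+n)}` bounded by `ρ` and of `aL⁻²Q*Q` by `ρ_B`, `ρ + ρ_B < γ₀` — `wRow`, `wCol`, convex-stable along the segment: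
  `wRow_interpOp_le`) ⟹ `|C(s)(x,y)| ≤ (γ₀ − ρ − ρ_B)⁻¹e^{−κd(x,y)}` UNIFORMLY IN `s ∈ [0,1]` (`covOp_decay` = the tree's
  `Balaban1983to89.QGQInverse.inverse_decay` applied to `C(s)⁻¹`; nothing of [Ba 4] Chap. 5 is thereby certified —
  the finite Combes–Thomas argument is [folklore]).
* §6 (4.40) → (4.41) with EXPLICIT constant (`triple_decay_bound`): outer kernels `≤ A₁e^{−κd}`, `A₂e^{−κd}`, middle
  kernel `≤ θe^{−κd}`, `Σ_z e^{−(κ/2)d(x,z)} ≤ V` ⟹ `|(K₁EK₂)(x,y)| ≤ A₁θA₂V²e^{−(κ/2)d(x,y)}`.  King keeps `δ₀` in (4.41)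
  under the generic-constant convention; the kernel version halves the rate and spends the other half on the two sums.
* §7 WHERE `L^{−k}` COMES FROM (`abs_le_sqrt_mul_exp_half`, `sub_kernel_rate`): Lemma 4.3 is a bound `O(L^{−2k})` on
  the Fourier SYMBOLS, i.e. (via (4.35), `abs_avg_le_of_symbol_le`) a SUP-NORM bound `ε = CL^{−2k}` on the kernel of
  `Δ^{(k+n)} − Δ^{(k)}`, while each of `Δ^{(k)}`, `Δ^{(k+n)}` decays like `C₁e^{−δ₀|z−w|}`; `min ≤ geometric mean` gives
  `|[Δ^{(k+n)} − Δ^{(k)}](z,w)| ≤ √(2C₁ε) e^{−(δ₀/2)|z−w|}` — rate `√(L^{−2k}) = L^{−k}`, the exponent printed in (4.38),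
  at half the decay rate.  (A rate `L^{−2k}` with full decay would need Lemma 4.3 on a complex strip, which King does
  not state; the print is consistent with the reading formalised here.)
* §8 **`lemma45`** = (4.38) assembled from the endpoint resolvent identity + §5 + §6:
  `|C^{(k)}(x,y) − C^{(k+n)}(x,y)| ≤ θ(γ₀ − ρ − ρ_B)⁻²V² e^{−(κ/2)d(x,y)}` with `θ` the position-space rate of
  `Δ^{(k+n)} − Δ^{(k)}` at decay `κ`; **`lemma45_via_integral`** = the same bound for King's `s`-integral (4.39) (the
  integrand obeys it for every `s`); **`lemma45_of_supRate`** = the same with `θ = √(2C₁ε)` produced from the sup-rate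
  `ε` and the decay of the two Laplacians as in §7.

**HYPOTHESES, NOT DERIVED HERE (King's inputs, each printed elsewhere).**  (a) (4.33) at the two endpoints, i.e.
`Δ^{(k)} + aL⁻²Q*Q ≥ γ₀` and `Δ^{(k+n)} + aL⁻²Q*Q ≥ γ₀` — King's Fourier bound (4.35)–(4.37) at `A = 0` ("It is easy to
see that Δ^{(k)}(p′) ≥ C|p′|²", (4.36) for `Q*Q`); (b) (4.34): the decay of the kernels of `Δ^{(k)}`, `Δ^{(k+n)}`
(Theorem 3.3 = [Ba 4]) and the short range of `Q*Q`, here in Combes–Thomas-summable form; (c) the rate input —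
either the position-space rate `θ` directly (`lemma45`) or the sup-norm rate `ε` of Lemma 4.3 (`lemma45_of_supRate`;
the symbol inequality itself is the tree's `King1986.lemma43_aK`, its transport to Ω's kernels through (4.35) is not
redone here); (d) the volume-independent sum `V`.  NOT COVERED: the passage to free boundary conditions "by
continuity" (infinite index sets), and anything with a background field — every statement of King's §4 is at `A = 0`
(*"and A = 0, of course"*, p. 670).

**How the cell uses this (pointers, not rulings).**  T4-DAG v1 §6 NE2 / row T4-U1a.E (tree `Balaban1983to89.T4EtaRate`,
shape `NE2PlusUnit` for the unit-lattice covariance `C^{(k)}(Λ)` of [Balaban1985BackgroundPropagators] Thm 3.15) names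
"King's resolvent interpolation (4.32) + B9 decay" as the proof PATTERN of the unprinted background-field η-rate.  This
file is that pattern as a kernel theorem over an arbitrary finite index set: an η-rate for a covariance
`(Δ + B)⁻¹` FOLLOWS from (i) coercivity of the two inverse covariances, (ii) Combes–Thomas-summable decay of their
pieces, (iii) an η-rate (sup-norm or position-space) for the DIFFERENCE of the two effective Laplacians — so the
covariance layer of NE2 reduces to the effective-Laplacian layer plus uniform inputs of the printed type.  Whether
(i)–(iii) hold for Bałaban's background-dependent, gauge-constrained, multi-region operators is exactly what is NOT in
print (TEMPLATE §18.2 (a)–(d)); nothing here asserts it.  No `def … : Prop` hypothesis is introduced; every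
declaration below is a definition with a body or a proved theorem.  Value = kernel reproduction of a printed `A = 0`
mechanism, NOT summit progress.
-/

noncomputable section

open Matrix Finset Real Filter Topology
open Literature.MathematicalPhysics.QuantumFieldTheory.Balaban1983to89.QGQInverse

namespace Literature.MathematicalPhysics.QuantumFieldTheory.King1986

variable {n : Type*} [Fintype n] [DecidableEq n]

/-! ## §1 The interpolating family (4.32) and the resolvent identity -/

/-- King's interpolating operator (4.32) BEFORE inversion, `C_Ω^{(k)}(s)⁻¹ = sΔ^{(k)} + (1−s)Δ^{(k+n)} + aL⁻²Q*Q`,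
over an abstract finite index set: `Δ₁ := Δ^{(k)}` (the `s = 1` endpoint), `Δ₀ := Δ^{(k+n)}` (the `s = 0` endpoint),
`B := aL⁻²Q*Q`. [cite: King1986, (4.32) p.674] -/
def interpOp (Δ₁ Δ₀ B : Matrix n n ℝ) (s : ℝ) : Matrix n n ℝ := s • Δ₁ + (1 - s) • Δ₀ + B

/-- King's `C_Ω^{(k)}(s) = (sΔ^{(k)} + (1−s)Δ^{(k+n)} + aL⁻²Q*Q)⁻¹` (4.32) (matrix inverse; it is a genuine two-sided
inverse whenever `interpOp … s` is a unit, in particular for `0 ≤ s ≤ 1` under the endpoint coercivity (4.33),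
`isUnit_interpOp`). `covOp … 1 = C^{(k)}`, `covOp … 0 = C^{(k+n)}` (`covOp_one`, `covOp_zero`). [cite: King1986, (4.32) p.674] -/
def covOp (Δ₁ Δ₀ B : Matrix n n ℝ) (s : ℝ) : Matrix n n ℝ := (interpOp Δ₁ Δ₀ B s)⁻¹

section algebra

variable (Δ₁ Δ₀ B : Matrix n n ℝ)

omit [Fintype n] [DecidableEq n] in
/-- `C(1)⁻¹ = Δ^{(k)} + aL⁻²Q*Q`. [cite: King1986, (4.32) p.674] -/
theorem interpOp_one : interpOp Δ₁ Δ₀ B 1 = Δ₁ + B := by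
  simp [interpOp]

omit [Fintype n] [DecidableEq n] in
/-- `C(0)⁻¹ = Δ^{(k+n)} + aL⁻²Q*Q`. [cite: King1986, (4.32) p.674] -/
theorem interpOp_zero : interpOp Δ₁ Δ₀ B 0 = Δ₀ + B := by
  simp [interpOp]

/-- `C(1) = C^{(k)} = (Δ^{(k)} + aL⁻²Q*Q)⁻¹` — King's (2.16). [cite: King1986, (2.16) p.653, (4.32) p.674] -/
theorem covOp_one : covOp Δ₁ Δ₀ B 1 = (Δ₁ + B)⁻¹ := by
  rw [covOp, interpOp_one]

/-- `C(0) = C^{(k+n)}`. [cite: King1986, (4.32) p.674] -/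
theorem covOp_zero : covOp Δ₁ Δ₀ B 0 = (Δ₀ + B)⁻¹ := by
  rw [covOp, interpOp_zero]

omit [Fintype n] [DecidableEq n] in
/-- The interpolation is affine in `s`: `C(s)⁻¹ − C(t)⁻¹ = (s − t)(Δ^{(k)} − Δ^{(k+n)})`. [folklore] -/
theorem interpOp_sub (s t : ℝ) : interpOp Δ₁ Δ₀ B s - interpOp Δ₁ Δ₀ B t = (s - t) • (Δ₁ - Δ₀) := by
  ext i j
  simp [interpOp, Matrix.sub_apply, Matrix.add_apply, Matrix.smul_apply]
  ring

omit [Fintype n] [DecidableEq n] in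
/-- Entrywise size of the interpolating operator for `0 ≤ s ≤ 1` (convexity). [folklore] -/
theorem abs_interpOp_apply_le {s : ℝ} (hs0 : 0 ≤ s) (hs1 : s ≤ 1) (i j : n) :
    |interpOp Δ₁ Δ₀ B s i j| ≤ s * |Δ₁ i j| + (1 - s) * |Δ₀ i j| + |B i j| := by
  have e : interpOp Δ₁ Δ₀ B s i j = s * Δ₁ i j + (1 - s) * Δ₀ i j + B i j := by
    simp [interpOp, Matrix.add_apply, Matrix.smul_apply]
  rw [e]
  calc |s * Δ₁ i j + (1 - s) * Δ₀ i j + B i j|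
      ≤ |s * Δ₁ i j + (1 - s) * Δ₀ i j| + |B i j| := abs_add_le _ _
    _ ≤ |s * Δ₁ i j| + |(1 - s) * Δ₀ i j| + |B i j| := add_le_add (abs_add_le _ _) le_rfl
    _ = s * |Δ₁ i j| + (1 - s) * |Δ₀ i j| + |B i j| := by
        rw [abs_mul, abs_mul, abs_of_nonneg hs0, abs_of_nonneg (by linarith : (0:ℝ) ≤ 1 - s)]

/-- **Resolvent identity** for matrices: `A⁻¹ − B⁻¹ = A⁻¹(B − A)B⁻¹` for units `A`, `B`. [folklore] -/
theorem inv_sub_inv_of_isUnit (A A' : Matrix n n ℝ) (hA : IsUnit A) (hA' : IsUnit A') :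
    A⁻¹ - A'⁻¹ = A⁻¹ * (A' - A) * A'⁻¹ := by
  have hAd : IsUnit A.det := (Matrix.isUnit_iff_isUnit_det A).mp hA
  have hA'd : IsUnit A'.det := (Matrix.isUnit_iff_isUnit_det A').mp hA'
  rw [Matrix.mul_sub, Matrix.sub_mul, Matrix.mul_assoc A⁻¹ A' A'⁻¹, Matrix.mul_nonsing_inv A' hA'd,
    Matrix.mul_one, Matrix.nonsing_inv_mul A hAd, Matrix.one_mul]

/-- King's (4.39)/(4.40) in DIFFERENCE form (exact, no derivative): for units `C(s)⁻¹`, `C(t)⁻¹`,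
`C(t) − C(s) = (t − s) · C(t) [Δ^{(k+n)} − Δ^{(k)}] C(s)`.  At `t = 1`, `s = 0` this is the endpoint resolvent identity
`C^{(k)} − C^{(k+n)} = C^{(k)} [Δ^{(k+n)} − Δ^{(k)}] C^{(k+n)}` (`covOp_one_sub_covOp_zero`). [cite: King1986, (4.39)–(4.40) pp.674–675] -/
theorem covOp_sub_covOp {s t : ℝ} (hs : IsUnit (interpOp Δ₁ Δ₀ B s)) (ht : IsUnit (interpOp Δ₁ Δ₀ B t)) :
    covOp Δ₁ Δ₀ B t - covOp Δ₁ Δ₀ B s = (t - s) • (covOp Δ₁ Δ₀ B t * (Δ₀ - Δ₁) * covOp Δ₁ Δ₀ B s) := by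
  unfold covOp
  rw [inv_sub_inv_of_isUnit _ _ ht hs, interpOp_sub, Matrix.mul_smul, Matrix.smul_mul,
    ← neg_sub Δ₀ Δ₁, Matrix.mul_neg, Matrix.neg_mul, smul_neg, ← neg_smul, neg_sub]

/-- Endpoint resolvent identity `C^{(k)} − C^{(k+n)} = C^{(k)} [Δ^{(k+n)} − Δ^{(k)}] C^{(k+n)}` (the `s`-integral of
(4.39) collapsed; it yields the bound (4.41) with the same constants, `lemma45`). [folklore] -/
theorem covOp_one_sub_covOp_zero (h1 : IsUnit (Δ₁ + B)) (h0 : IsUnit (Δ₀ + B)) :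
    (Δ₁ + B)⁻¹ - (Δ₀ + B)⁻¹ = (Δ₁ + B)⁻¹ * (Δ₀ - Δ₁) * (Δ₀ + B)⁻¹ := by
  have h1' : IsUnit (interpOp Δ₁ Δ₀ B 1) := by rwa [interpOp_one]
  have h0' : IsUnit (interpOp Δ₁ Δ₀ B 0) := by rwa [interpOp_zero]
  have := covOp_sub_covOp Δ₁ Δ₀ B h0' h1'
  simpa [covOp_one, covOp_zero] using this

end algebra

/-! ## §2 Coercivity (4.33) along the segment FROM the two endpoints, and the uniform entry bound -/

section coercive

variable (Δ₁ Δ₀ B : Matrix n n ℝ)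

omit [DecidableEq n] in
/-- The quadratic form of the interpolating operator is the convex combination of the endpoint forms. [folklore] -/
theorem form_interpOp (s : ℝ) (x : n → ℝ) :
    x ⬝ᵥ (interpOp Δ₁ Δ₀ B s *ᵥ x)
      = s * (x ⬝ᵥ ((Δ₁ + B) *ᵥ x)) + (1 - s) * (x ⬝ᵥ ((Δ₀ + B) *ᵥ x)) := by
  simp only [interpOp, Matrix.add_mulVec, Matrix.smul_mulVec, dotProduct_add, dotProduct_smul,
    smul_eq_mul, Matrix.sub_mulVec, sub_smul, one_smul, dotProduct_sub]
  ring

omit [DecidableEq n] in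
/-- **(4.33) for all `0 ≤ s ≤ 1` from the endpoints.**  If `C^{(k)⁻¹} = Δ^{(k)} + aL⁻²Q*Q ≥ γ₀I` and
`C^{(k+n)⁻¹} = Δ^{(k+n)} + aL⁻²Q*Q ≥ γ₀I` then `C_Ω^{(k)}(s)⁻¹ ≥ γ₀I` for every `s ∈ [0,1]` (convexity of the segment).
King proves (4.33) directly by the Fourier bound (4.35)–(4.37) at `A = 0`; that input is NOT reproduced here — only its
propagation along the segment. [cite: King1986, (4.33), (4.37) p.674] -/
theorem coercive_interpOp {γ : ℝ} (h1 : Coercive (Δ₁ + B) γ) (h0 : Coercive (Δ₀ + B) γ)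
    {s : ℝ} (hs0 : 0 ≤ s) (hs1 : s ≤ 1) : Coercive (interpOp Δ₁ Δ₀ B s) γ := by
  intro x
  rw [form_interpOp]
  have e1 := h1 x
  have e0 := h0 x
  have hs1' : 0 ≤ 1 - s := by linarith
  have m1 := mul_le_mul_of_nonneg_left e1 hs0
  have m0 := mul_le_mul_of_nonneg_left e0 hs1'
  have split : γ * (x ⬝ᵥ x) = s * (γ * (x ⬝ᵥ x)) + (1 - s) * (γ * (x ⬝ᵥ x)) := by ring
  rw [split]
  exact add_le_add m1 m0

/-- `C_Ω^{(k)}(s)⁻¹` is a unit for `0 ≤ s ≤ 1` under the endpoint coercivity with `γ₀ > 0`. [folklore] -/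
theorem isUnit_interpOp {γ : ℝ} (hγ : 0 < γ) (h1 : Coercive (Δ₁ + B) γ) (h0 : Coercive (Δ₀ + B) γ)
    {s : ℝ} (hs0 : 0 ≤ s) (hs1 : s ≤ 1) : IsUnit (interpOp Δ₁ Δ₀ B s) :=
  isUnit_of_coercive hγ (coercive_interpOp Δ₁ Δ₀ B h1 h0 hs0 hs1)

/-- Uniform entry bound `|C(s)(x,y)| ≤ γ₀⁻¹`, `0 ≤ s ≤ 1`. [folklore] -/
theorem abs_covOp_apply_le_inv {γ : ℝ} (hγ : 0 < γ) (h1 : Coercive (Δ₁ + B) γ) (h0 : Coercive (Δ₀ + B) γ)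
    {s : ℝ} (hs0 : 0 ≤ s) (hs1 : s ≤ 1) (i j : n) : |covOp Δ₁ Δ₀ B s i j| ≤ γ⁻¹ :=
  inv_entry_le_of_coercive hγ (coercive_interpOp Δ₁ Δ₀ B h1 h0 hs0 hs1) i j

end coercive

/-! ## §3 Entry bounds for a sandwich `T E S` (used for (4.40)–(4.41) and for the `s`-regularity of `C(s)`) -/

section sandwich

omit [DecidableEq n] in
/-- `|(T E S)(i,j)| ≤ Σ_z Σ_w |T(i,z)| |E(z,w)| |S(w,j)|`. [folklore] -/
theorem abs_mul_mul_apply_le (T E S : Matrix n n ℝ) (i j : n) :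
    |(T * E * S) i j| ≤ ∑ z, ∑ w, |T i z| * |E z w| * |S w j| := by
  have e : (T * E * S) i j = ∑ z, ∑ w, T i z * E z w * S w j := by
    simp only [Matrix.mul_apply, Finset.sum_mul]
    rw [Finset.sum_comm]
  rw [e]
  refine (Finset.abs_sum_le_sum_abs _ _).trans (Finset.sum_le_sum fun z _ => ?_)
  refine (Finset.abs_sum_le_sum_abs _ _).trans (Finset.sum_le_sum fun w _ => ?_)
  rw [abs_mul, abs_mul]

omit [DecidableEq n] in
/-- Uniform entry bounds on the two outer factors: `|(T E S)(i,j)| ≤ a b Σ_z Σ_w |E(z,w)|`. [folklore] -/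
theorem abs_mul_mul_apply_le_of_entry_le (T E S : Matrix n n ℝ) {a b : ℝ} (ha : 0 ≤ a)
    (hT : ∀ i j, |T i j| ≤ a) (hS : ∀ i j, |S i j| ≤ b) (i j : n) :
    |(T * E * S) i j| ≤ a * b * ∑ z, ∑ w, |E z w| := by
  refine (abs_mul_mul_apply_le T E S i j).trans ?_
  rw [Finset.mul_sum]
  refine Finset.sum_le_sum fun z _ => ?_
  rw [Finset.mul_sum]
  refine Finset.sum_le_sum fun w _ => ?_
  have h1 := hT i z
  have h2 := hS w j
  have hE := abs_nonneg (E z w)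
  calc |T i z| * |E z w| * |S w j| ≤ a * |E z w| * b :=
        mul_le_mul (mul_le_mul_of_nonneg_right h1 hE) h2 (abs_nonneg _) (mul_nonneg ha hE)
    _ = a * b * |E z w| := by ring

end sandwich

/-! ## §4 King's route as printed: `s`-regularity of `C(s)`, the derivative, and the integral formula (4.39)–(4.40) -/

section interpolation

variable (Δ₁ Δ₀ B : Matrix n n ℝ)

/-- Lipschitz continuity of every entry of `C(s)` on `[0,1]`, with the explicit constant
`γ₀⁻² Σ_{z,w} |Δ^{(k+n)}(z,w) − Δ^{(k)}(z,w)|` (from the difference form of (4.39) and the uniform entry bound). [folklore] -/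
theorem abs_covOp_sub_covOp_le {γ : ℝ} (hγ : 0 < γ) (h1 : Coercive (Δ₁ + B) γ) (h0 : Coercive (Δ₀ + B) γ)
    {s t : ℝ} (hs : s ∈ Set.Icc (0:ℝ) 1) (ht : t ∈ Set.Icc (0:ℝ) 1) (i j : n) :
    |covOp Δ₁ Δ₀ B t i j - covOp Δ₁ Δ₀ B s i j|
      ≤ |t - s| * (γ⁻¹ * γ⁻¹ * ∑ z, ∑ w, |(Δ₀ - Δ₁) z w|) := by
  have hsU := isUnit_interpOp Δ₁ Δ₀ B hγ h1 h0 hs.1 hs.2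
  have htU := isUnit_interpOp Δ₁ Δ₀ B hγ h1 h0 ht.1 ht.2
  have e := covOp_sub_covOp Δ₁ Δ₀ B hsU htU
  have e' : covOp Δ₁ Δ₀ B t i j - covOp Δ₁ Δ₀ B s i j
      = (t - s) * (covOp Δ₁ Δ₀ B t * (Δ₀ - Δ₁) * covOp Δ₁ Δ₀ B s) i j := by
    have := congrArg (fun M : Matrix n n ℝ => M i j) e
    simpa [Matrix.sub_apply, Matrix.smul_apply] using this
  rw [e', abs_mul]
  gcongr
  exact abs_mul_mul_apply_le_of_entry_le _ _ _ (inv_nonneg.mpr hγ.le)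
    (abs_covOp_apply_le_inv Δ₁ Δ₀ B hγ h1 h0 ht.1 ht.2)
    (abs_covOp_apply_le_inv Δ₁ Δ₀ B hγ h1 h0 hs.1 hs.2) i j

/-- Every entry `s ↦ C(s)(i,j)` is continuous on `[0,1]`. [folklore] -/
theorem continuousOn_covOp_apply {γ : ℝ} (hγ : 0 < γ) (h1 : Coercive (Δ₁ + B) γ)
    (h0 : Coercive (Δ₀ + B) γ) (i j : n) :
    ContinuousOn (fun s => covOp Δ₁ Δ₀ B s i j) (Set.Icc (0:ℝ) 1) := by
  set K : ℝ := γ⁻¹ * γ⁻¹ * ∑ z, ∑ w, |(Δ₀ - Δ₁) z w| with hK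
  have hK0 : 0 ≤ K := by
    have : 0 ≤ γ⁻¹ := inv_nonneg.mpr hγ.le
    positivity
  intro s hs
  rw [Metric.continuousWithinAt_iff]
  intro ε hε
  refine ⟨ε / (K + 1), by positivity, ?_⟩
  intro t ht hdist
  rw [Real.dist_eq] at hdist ⊢
  calc |covOp Δ₁ Δ₀ B t i j - covOp Δ₁ Δ₀ B s i j| ≤ |t - s| * K :=
        abs_covOp_sub_covOp_le Δ₁ Δ₀ B hγ h1 h0 hs ht i j
    _ ≤ ε / (K + 1) * K := mul_le_mul_of_nonneg_right hdist.le hK0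
    _ < ε := by
        rw [div_mul_eq_mul_div, div_lt_iff₀ (by positivity)]
        nlinarith

/-- King's integrand (4.40): `(d/ds) C(s)(x,y) = Σ_{z,w} C(s)(x,z) [Δ^{(k+n)}(z,w) − Δ^{(k)}(z,w)] C(s)(w,y)`.
[cite: King1986, (4.40) p.675] -/
def dcovOp (s : ℝ) : Matrix n n ℝ := covOp Δ₁ Δ₀ B s * (Δ₀ - Δ₁) * covOp Δ₁ Δ₀ B s

/-- The integrand (4.40) is continuous on `[0,1]` (entrywise). [folklore] -/
theorem continuousOn_dcovOp_apply {γ : ℝ} (hγ : 0 < γ) (h1 : Coercive (Δ₁ + B) γ)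
    (h0 : Coercive (Δ₀ + B) γ) (i j : n) :
    ContinuousOn (fun s => dcovOp Δ₁ Δ₀ B s i j) (Set.Icc (0:ℝ) 1) := by
  have e : (fun s => dcovOp Δ₁ Δ₀ B s i j)
      = fun s => ∑ w, (∑ z, covOp Δ₁ Δ₀ B s i z * (Δ₀ - Δ₁) z w) * covOp Δ₁ Δ₀ B s w j := by
    funext s; simp only [dcovOp, Matrix.mul_apply]
  rw [e]
  refine continuousOn_finsetSum _ fun w _ => ContinuousOn.mul ?_
    (continuousOn_covOp_apply Δ₁ Δ₀ B hγ h1 h0 w j)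
  exact continuousOn_finsetSum _ fun z _ =>
    (continuousOn_covOp_apply Δ₁ Δ₀ B hγ h1 h0 i z).mul continuousOn_const

/-- **(4.39), first equality: the derivative.**  For `0 < s < 1`,
`(d/ds) C(s)(x,y) = (C(s) [Δ^{(k+n)} − Δ^{(k)}] C(s))(x,y)` — from the exact difference form `covOp_sub_covOp` and
the continuity of `C(·)`.  (King writes the derivative of the Gaussian expectation `⟨φ(x)φ(y)⟩_s` as a truncated
expectation and evaluates it: "Explicit computation gives (4.40)".) [cite: King1986, (4.39)–(4.40) pp.674–675] -/
theorem hasDerivAt_covOp_apply {γ : ℝ} (hγ : 0 < γ) (h1 : Coercive (Δ₁ + B) γ)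
    (h0 : Coercive (Δ₀ + B) γ) {s : ℝ} (hs : s ∈ Set.Ioo (0:ℝ) 1) (i j : n) :
    HasDerivAt (fun t => covOp Δ₁ Δ₀ B t i j) (dcovOp Δ₁ Δ₀ B s i j) s := by
  rw [hasDerivAt_iff_tendsto_slope]
  have hsI : s ∈ Set.Icc (0:ℝ) 1 := ⟨hs.1.le, hs.2.le⟩
  have hsU := isUnit_interpOp Δ₁ Δ₀ B hγ h1 h0 hsI.1 hsI.2
  -- the slope equals the sandwich `(C(t) E C(s))(i,j)` for `t ∈ (0,1)`, `t ≠ s`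
  set g : ℝ → ℝ := fun t => (covOp Δ₁ Δ₀ B t * (Δ₀ - Δ₁) * covOp Δ₁ Δ₀ B s) i j with hg
  have hev : slope (fun t => covOp Δ₁ Δ₀ B t i j) s =ᶠ[𝓝[≠] s] g := by
    have hIoo : Set.Ioo (0:ℝ) 1 ∈ 𝓝[≠] s := mem_nhdsWithin_of_mem_nhds (Ioo_mem_nhds hs.1 hs.2)
    filter_upwards [hIoo, self_mem_nhdsWithin] with t ht hts
    have htU := isUnit_interpOp Δ₁ Δ₀ B hγ h1 h0 ht.1.le ht.2.le
    have e := covOp_sub_covOp Δ₁ Δ₀ B hsU htU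
    have e' : covOp Δ₁ Δ₀ B t i j - covOp Δ₁ Δ₀ B s i j = (t - s) * g t := by
      have := congrArg (fun M : Matrix n n ℝ => M i j) e
      simpa [hg, Matrix.sub_apply, Matrix.smul_apply] using this
    have hts' : t - s ≠ 0 := sub_ne_zero.mpr (Set.mem_compl_singleton_iff.mp hts)
    simp only [slope_def_field]
    rw [e', mul_div_cancel_left₀ _ hts']
  refine Filter.Tendsto.congr' hev.symm ?_
  -- `g` is continuous at `s` and `g s` is the claimed derivative
  have hgs : g s = dcovOp Δ₁ Δ₀ B s i j := rfl
  rw [← hgs]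
  have hcont : ContinuousOn g (Set.Icc (0:ℝ) 1) := by
    have e : g = fun t => ∑ w, (∑ z, covOp Δ₁ Δ₀ B t i z * (Δ₀ - Δ₁) z w) * covOp Δ₁ Δ₀ B s w j := by
      funext t; simp only [hg, Matrix.mul_apply]
    rw [e]
    refine continuousOn_finsetSum _ fun w _ => ContinuousOn.mul ?_ continuousOn_const
    exact continuousOn_finsetSum _ fun z _ =>
      (continuousOn_covOp_apply Δ₁ Δ₀ B hγ h1 h0 i z).mul continuousOn_const
  have hca : ContinuousAt g s := hcont.continuousAt (Icc_mem_nhds hs.1 hs.2)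
  exact hca.tendsto.mono_left nhdsWithin_le_nhds

/-- **(4.39)–(4.40), King's resolvent interpolation formula:**
`C^{(k)}(x,y) − C^{(k+n)}(x,y) = ∫₀¹ ds Σ_{z,w} C(s)(x,z) [Δ^{(k+n)}(z,w) − Δ^{(k)}(z,w)] C(s)(w,y)`,
proved here from the endpoint coercivity (4.33) with `γ₀ > 0` (fundamental theorem of calculus for the
entrywise-`C¹` family `C(s)`). [cite: King1986, Lemma 4.5 proof, (4.39)–(4.40) pp.674–675] -/
theorem covOp_one_sub_zero_eq_integral {γ : ℝ} (hγ : 0 < γ) (h1 : Coercive (Δ₁ + B) γ)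
    (h0 : Coercive (Δ₀ + B) γ) (i j : n) :
    covOp Δ₁ Δ₀ B 1 i j - covOp Δ₁ Δ₀ B 0 i j = ∫ s in (0:ℝ)..1, dcovOp Δ₁ Δ₀ B s i j := by
  rw [intervalIntegral.integral_eq_sub_of_hasDerivAt_of_le zero_le_one
    (continuousOn_covOp_apply Δ₁ Δ₀ B hγ h1 h0 i j)
    (fun s hs => hasDerivAt_covOp_apply Δ₁ Δ₀ B hγ h1 h0 hs i j)
    ((continuousOn_dcovOp_apply Δ₁ Δ₀ B hγ h1 h0 i j).intervalIntegrable_of_Icc zero_le_one)]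

end interpolation

/-! ## §5 Uniform exponential decay of `C(s)` — King's "general results of Chap. 5 of [Ba 4]" step, here the tree's
finite Combes–Thomas lemma `QGQInverse.inverse_decay` applied along the segment -/

section decay

/-- Weighted off-diagonal ROW sum `Σ_j |M(i,j)| (e^{κ d(i,j)} − 1)` — the quantity the Combes–Thomas lemma
`QGQInverse.inverse_decay` asks to be `≤ ρ < γ₀`. [folklore] -/
def wRow (M : Matrix n n ℝ) (d : n → n → ℝ) (κ : ℝ) (i : n) : ℝ :=
  ∑ j, |M i j| * (Real.exp (κ * d i j) - 1)

/-- Weighted off-diagonal COLUMN sum `Σ_i |M(i,j)| (e^{κ d(i,j)} − 1)`. [folklore] -/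
def wCol (M : Matrix n n ℝ) (d : n → n → ℝ) (κ : ℝ) (j : n) : ℝ :=
  ∑ i, |M i j| * (Real.exp (κ * d i j) - 1)

omit [Fintype n] [DecidableEq n] in
/-- A pseudo-metric given by the three axioms of `inverse_decay` is nonnegative. [folklore] -/
theorem pseudo_nonneg (d : n → n → ℝ) (hd_symm : ∀ i j, d i j = d j i) (hd_zero : ∀ i, d i i = 0)
    (hd_tri : ∀ i j k, d i k ≤ d i j + d j k) (i j : n) : 0 ≤ d i j := by
  have := hd_tri i j i
  rw [hd_zero, hd_symm j i] at this
  linarith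

variable (Δ₁ Δ₀ B : Matrix n n ℝ)

omit [DecidableEq n] in
/-- The weighted row sums of the interpolating operator are convex-dominated by those of its three pieces.
[folklore] -/
theorem wRow_interpOp_le (d : n → n → ℝ) {κ : ℝ} (hκ : 0 ≤ κ) (hd : ∀ i j, 0 ≤ d i j)
    {s : ℝ} (hs0 : 0 ≤ s) (hs1 : s ≤ 1) {ρ ρB : ℝ} (i : n)
    (h1 : wRow Δ₁ d κ i ≤ ρ) (h0 : wRow Δ₀ d κ i ≤ ρ) (hB : wRow B d κ i ≤ ρB) :
    wRow (interpOp Δ₁ Δ₀ B s) d κ i ≤ ρ + ρB := by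
  unfold wRow at *
  have hw : ∀ j, 0 ≤ Real.exp (κ * d i j) - 1 := fun j => by
    have : 1 ≤ Real.exp (κ * d i j) := Real.one_le_exp (mul_nonneg hκ (hd i j))
    linarith
  calc ∑ j, |interpOp Δ₁ Δ₀ B s i j| * (Real.exp (κ * d i j) - 1)
      ≤ ∑ j, (s * |Δ₁ i j| + (1 - s) * |Δ₀ i j| + |B i j|) * (Real.exp (κ * d i j) - 1) :=
        Finset.sum_le_sum fun j _ =>
          mul_le_mul_of_nonneg_right (abs_interpOp_apply_le Δ₁ Δ₀ B hs0 hs1 i j) (hw j)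
    _ = s * ∑ j, |Δ₁ i j| * (Real.exp (κ * d i j) - 1)
        + (1 - s) * ∑ j, |Δ₀ i j| * (Real.exp (κ * d i j) - 1)
        + ∑ j, |B i j| * (Real.exp (κ * d i j) - 1) := by
        rw [Finset.mul_sum, Finset.mul_sum, ← Finset.sum_add_distrib, ← Finset.sum_add_distrib]
        refine Finset.sum_congr rfl fun j _ => ?_
        ring
    _ ≤ s * ρ + (1 - s) * ρ + ρB := by
        have hs1' : 0 ≤ 1 - s := by linarith
        exact add_le_add (add_le_add (mul_le_mul_of_nonneg_left h1 hs0)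
          (mul_le_mul_of_nonneg_left h0 hs1')) hB
    _ = ρ + ρB := by ring

omit [DecidableEq n] in
/-- Column version of `wRow_interpOp_le`. [folklore] -/
theorem wCol_interpOp_le (d : n → n → ℝ) {κ : ℝ} (hκ : 0 ≤ κ) (hd : ∀ i j, 0 ≤ d i j)
    {s : ℝ} (hs0 : 0 ≤ s) (hs1 : s ≤ 1) {ρ ρB : ℝ} (j : n)
    (h1 : wCol Δ₁ d κ j ≤ ρ) (h0 : wCol Δ₀ d κ j ≤ ρ) (hB : wCol B d κ j ≤ ρB) :
    wCol (interpOp Δ₁ Δ₀ B s) d κ j ≤ ρ + ρB := by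
  unfold wCol at *
  have hw : ∀ i, 0 ≤ Real.exp (κ * d i j) - 1 := fun i => by
    have : 1 ≤ Real.exp (κ * d i j) := Real.one_le_exp (mul_nonneg hκ (hd i j))
    linarith
  calc ∑ i, |interpOp Δ₁ Δ₀ B s i j| * (Real.exp (κ * d i j) - 1)
      ≤ ∑ i, (s * |Δ₁ i j| + (1 - s) * |Δ₀ i j| + |B i j|) * (Real.exp (κ * d i j) - 1) :=
        Finset.sum_le_sum fun i _ =>
          mul_le_mul_of_nonneg_right (abs_interpOp_apply_le Δ₁ Δ₀ B hs0 hs1 i j) (hw i)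
    _ = s * ∑ i, |Δ₁ i j| * (Real.exp (κ * d i j) - 1)
        + (1 - s) * ∑ i, |Δ₀ i j| * (Real.exp (κ * d i j) - 1)
        + ∑ i, |B i j| * (Real.exp (κ * d i j) - 1) := by
        rw [Finset.mul_sum, Finset.mul_sum, ← Finset.sum_add_distrib, ← Finset.sum_add_distrib]
        refine Finset.sum_congr rfl fun i _ => ?_
        ring
    _ ≤ s * ρ + (1 - s) * ρ + ρB := by
        have hs1' : 0 ≤ 1 - s := by linarith
        exact add_le_add (add_le_add (mul_le_mul_of_nonneg_left h1 hs0)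
          (mul_le_mul_of_nonneg_left h0 hs1')) hB
    _ = ρ + ρB := by ring

/-- **Uniform exponential decay of `C_Ω^{(k)}(s)`, `0 ≤ s ≤ 1`** — King p.674: *"Using the general results of Chap. 5
of [Ba 4], C_Ω^{(k)}(s) has uniform exponential decay if the following conditions hold: (i) C_Ω^{(k)}(s)⁻¹ ≥ γ₀I,
(4.33) (ii) |C_Ω^{(k)}(s)⁻¹(x,y)| ≤ C exp[−δ₀|x−y|]. (4.34)"*.  Here: (i) at the two ENDPOINTS (propagated by
`coercive_interpOp`), (ii) in the summable form the finite Combes–Thomas lemma consumes — weighted off-diagonal row and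
column sums of `Δ^{(k)}`, `Δ^{(k+n)}` (each `≤ ρ`) and of `aL⁻²Q*Q` (`≤ ρ_B`) at weight `e^{κ d} − 1`, with
`ρ + ρ_B < γ₀` — give `|C(s)(x,y)| ≤ (γ₀ − ρ − ρ_B)⁻¹ e^{−κ d(x,y)}` for every `s ∈ [0,1]`.
[cite: King1986, (4.33)–(4.34) p.674] -/
theorem covOp_decay (d : n → n → ℝ) {γ κ ρ ρB : ℝ} (hγ : ρ + ρB < γ) (hκ : 0 ≤ κ)
    (h1 : Coercive (Δ₁ + B) γ) (h0 : Coercive (Δ₀ + B) γ)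
    (hd_symm : ∀ i j, d i j = d j i) (hd_zero : ∀ i, d i i = 0)
    (hd_tri : ∀ i j k, d i k ≤ d i j + d j k)
    (hr1 : ∀ i, wRow Δ₁ d κ i ≤ ρ) (hr0 : ∀ i, wRow Δ₀ d κ i ≤ ρ) (hrB : ∀ i, wRow B d κ i ≤ ρB)
    (hc1 : ∀ j, wCol Δ₁ d κ j ≤ ρ) (hc0 : ∀ j, wCol Δ₀ d κ j ≤ ρ) (hcB : ∀ j, wCol B d κ j ≤ ρB)
    {s : ℝ} (hs0 : 0 ≤ s) (hs1 : s ≤ 1) (i j : n) :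
    |covOp Δ₁ Δ₀ B s i j| ≤ (γ - (ρ + ρB))⁻¹ * Real.exp (-(κ * d i j)) := by
  have hd := pseudo_nonneg d hd_symm hd_zero hd_tri
  exact inverse_decay (interpOp Δ₁ Δ₀ B s) d hγ hκ (coercive_interpOp Δ₁ Δ₀ B h1 h0 hs0 hs1)
    hd_symm hd_zero hd_tri
    (fun i => wRow_interpOp_le Δ₁ Δ₀ B d hκ hd hs0 hs1 i (hr1 i) (hr0 i) (hrB i))
    (fun j => wCol_interpOp_le Δ₁ Δ₀ B d hκ hd hs0 hs1 j (hc1 j) (hc0 j) (hcB j)) i j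

end decay

/-! ## §6 The triple sum (4.40) → (4.41): two decaying covariances around a SMALL decaying middle factor -/

section triple

omit [DecidableEq n] in
/-- **(4.41) with explicit constant and halved rate.**  If `|K₁(x,z)| ≤ A₁e^{−κd(x,z)}`,
`|E(z,w)| ≤ θe^{−κd(z,w)}`, `|K₂(w,y)| ≤ A₂e^{−κd(w,y)}` and `Σ_z e^{−(κ/2)d(x,z)} ≤ V` for all `x`, then
`|(K₁EK₂)(x,y)| ≤ A₁θA₂V² e^{−(κ/2)d(x,y)}`.  King: *"|(4.40)| ≤ CL^{−k} Σ_{z,w∈Ω} exp[−δ₀|x−z| − δ₀|z−w| − δ₀|w−y|]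
≤ CL^{−k} exp[−δ₀|x−y|]. (4.41)"* (generic constants; the kernel version keeps half the rate in the exponent and
puts the other half into the two convergent sums). [cite: King1986, (4.41) p.675] -/
theorem triple_decay_bound (d : n → n → ℝ) (hd_nonneg : ∀ i j, 0 ≤ d i j)
    (hd_tri : ∀ i j k, d i k ≤ d i j + d j k)
    (K₁ E K₂ : Matrix n n ℝ) {κ A₁ θ A₂ V : ℝ} (hκ : 0 ≤ κ) (hA₁ : 0 ≤ A₁) (hθ : 0 ≤ θ)
    (h1 : ∀ x z, |K₁ x z| ≤ A₁ * Real.exp (-(κ * d x z)))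
    (hE : ∀ z w, |E z w| ≤ θ * Real.exp (-(κ * d z w)))
    (h2 : ∀ w y, |K₂ w y| ≤ A₂ * Real.exp (-(κ * d w y)))
    (hV : ∀ x, ∑ z, Real.exp (-(κ / 2 * d x z)) ≤ V) (x y : n) :
    |(K₁ * E * K₂) x y| ≤ A₁ * θ * A₂ * V ^ 2 * Real.exp (-(κ / 2 * d x y)) := by
  have hV0 : 0 ≤ V := (Finset.sum_nonneg fun z _ => (Real.exp_pos _).le).trans (hV x)
  have hA₂ : 0 ≤ A₂ := by
    have h0 := (abs_nonneg _).trans (h2 y y)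
    have hpos := Real.exp_pos (-(κ * d y y))
    have h0' : 0 * Real.exp (-(κ * d y y)) ≤ A₂ * Real.exp (-(κ * d y y)) := by rwa [zero_mul]
    exact le_of_mul_le_mul_right h0' hpos
  -- pointwise bound of each summand
  have hc : 0 ≤ A₁ * θ * A₂ := mul_nonneg (mul_nonneg hA₁ hθ) hA₂
  have hpt : ∀ z w, |K₁ x z| * |E z w| * |K₂ w y|
      ≤ (A₁ * θ * A₂ * Real.exp (-(κ / 2 * d x y)))
        * (Real.exp (-(κ / 2 * d x z)) * Real.exp (-(κ / 2 * d z w))) := by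
    intro z w
    have e3 : Real.exp (-(κ * d x z)) * Real.exp (-(κ * d z w)) * Real.exp (-(κ * d w y))
        ≤ Real.exp (-(κ / 2 * d x y)) * (Real.exp (-(κ / 2 * d x z)) * Real.exp (-(κ / 2 * d z w))) := by
      rw [← Real.exp_add, ← Real.exp_add, ← Real.exp_add, ← Real.exp_add]
      apply Real.exp_le_exp.mpr
      have t3 : d x y ≤ d x z + d z w + d w y := by
        have t1 := hd_tri x z y
        have t2 := hd_tri z w y
        linarith
      have m3 := mul_le_mul_of_nonneg_left t3 hκ
      have m4 := mul_nonneg hκ (hd_nonneg w y)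
      have m5 := mul_nonneg hκ (hd_nonneg x z)
      have m6 := mul_nonneg hκ (hd_nonneg z w)
      linarith
    have a1 := h1 x z
    have a2 := hE z w
    have a3 := h2 w y
    have p1 := (Real.exp_pos (-(κ * d x z))).le
    have p2 := (Real.exp_pos (-(κ * d z w))).le
    calc |K₁ x z| * |E z w| * |K₂ w y|
        ≤ (A₁ * Real.exp (-(κ * d x z))) * (θ * Real.exp (-(κ * d z w)))
            * (A₂ * Real.exp (-(κ * d w y))) :=
          mul_le_mul (mul_le_mul a1 a2 (abs_nonneg _) (mul_nonneg hA₁ p1)) a3 (abs_nonneg _)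
            (mul_nonneg (mul_nonneg hA₁ p1) (mul_nonneg hθ p2))
      _ = (A₁ * θ * A₂)
            * (Real.exp (-(κ * d x z)) * Real.exp (-(κ * d z w)) * Real.exp (-(κ * d w y))) := by ring
      _ ≤ (A₁ * θ * A₂) * (Real.exp (-(κ / 2 * d x y))
            * (Real.exp (-(κ / 2 * d x z)) * Real.exp (-(κ / 2 * d z w)))) :=
          mul_le_mul_of_nonneg_left e3 hc
      _ = _ := by ring
  have hc' : 0 ≤ A₁ * θ * A₂ * Real.exp (-(κ / 2 * d x y)) := mul_nonneg hc (Real.exp_pos _).le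
  calc |(K₁ * E * K₂) x y| ≤ ∑ z, ∑ w, |K₁ x z| * |E z w| * |K₂ w y| := abs_mul_mul_apply_le K₁ E K₂ x y
    _ ≤ ∑ z, ∑ w, (A₁ * θ * A₂ * Real.exp (-(κ / 2 * d x y)))
          * (Real.exp (-(κ / 2 * d x z)) * Real.exp (-(κ / 2 * d z w))) :=
        Finset.sum_le_sum fun z _ => Finset.sum_le_sum fun w _ => hpt z w
    _ = (A₁ * θ * A₂ * Real.exp (-(κ / 2 * d x y)))
          * ∑ z, Real.exp (-(κ / 2 * d x z)) * ∑ w, Real.exp (-(κ / 2 * d z w)) := by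
        rw [Finset.mul_sum]
        refine Finset.sum_congr rfl fun z _ => ?_
        rw [Finset.mul_sum, Finset.mul_sum]
    _ ≤ (A₁ * θ * A₂ * Real.exp (-(κ / 2 * d x y))) * ∑ z, Real.exp (-(κ / 2 * d x z)) * V := by
        apply mul_le_mul_of_nonneg_left _ hc'
        exact Finset.sum_le_sum fun z _ => mul_le_mul_of_nonneg_left (hV z) (Real.exp_pos _).le
    _ ≤ (A₁ * θ * A₂ * Real.exp (-(κ / 2 * d x y))) * (V * V) := by
        rw [← Finset.sum_mul]
        exact mul_le_mul_of_nonneg_left (mul_le_mul_of_nonneg_right (hV x) hV0) hc'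
    _ = A₁ * θ * A₂ * V ^ 2 * Real.exp (-(κ / 2 * d x y)) := by ring

end triple

/-! ## §7 Where the rate `L^{-k}` comes from: Lemma 4.3 (symbols, `L^{-2k}`) + uniform decay (kernels) -/

section rate

/-- **`min ≤ geometric mean`, the located bookkeeping of "Combining Lemma 4.3 and the uniform exponential decay of
Δ^{(k)}" (p.675).**  A kernel entry bounded BOTH by a small sup-norm `ε` (Lemma 4.3: the Fourier symbols differ by
`O(L^{−2k})`, so the position-space kernel of `Δ^{(k+n)} − Δ^{(k)}` is `O(L^{−2k})` entrywise) AND by a decaying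
majorant `A e^{−δt}` (each of `Δ^{(k)}`, `Δ^{(k+n)}` decays, Theorem 3.3) is bounded by `√(εA) e^{−(δ/2)t}`:
rate `√(L^{−2k}) = L^{−k}` — the exponent printed in (4.38) — at half the decay rate. [folklore] -/
theorem abs_le_sqrt_mul_exp_half {e ε A δ t : ℝ} (hε : 0 ≤ ε) (h1 : |e| ≤ ε)
    (h2 : |e| ≤ A * Real.exp (-(δ * t))) :
    |e| ≤ Real.sqrt (ε * A) * Real.exp (-(δ / 2 * t)) := by
  have hpos := Real.exp_pos (-(δ * t))
  have hA : 0 ≤ A := by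
    have h0 := (abs_nonneg e).trans h2
    have h0' : 0 * Real.exp (-(δ * t)) ≤ A * Real.exp (-(δ * t)) := by rwa [zero_mul]
    exact le_of_mul_le_mul_right h0' hpos
  have hR : 0 ≤ Real.sqrt (ε * A) * Real.exp (-(δ / 2 * t)) :=
    mul_nonneg (Real.sqrt_nonneg _) (Real.exp_pos _).le
  have hsq : |e| ^ 2 ≤ (Real.sqrt (ε * A) * Real.exp (-(δ / 2 * t))) ^ 2 := by
    have e2 : (Real.sqrt (ε * A) * Real.exp (-(δ / 2 * t))) ^ 2 = ε * (A * Real.exp (-(δ * t))) := by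
      rw [mul_pow, Real.sq_sqrt (mul_nonneg hε hA), sq, ← Real.exp_add]
      ring_nf
    rw [e2, sq]
    exact mul_le_mul h1 h2 (abs_nonneg e) hε
  have h3 : |e| = Real.sqrt (|e| ^ 2) := (Real.sqrt_sq (abs_nonneg e)).symm
  rw [h3]
  calc Real.sqrt (|e| ^ 2) ≤ Real.sqrt ((Real.sqrt (ε * A) * Real.exp (-(δ / 2 * t))) ^ 2) :=
        Real.sqrt_le_sqrt hsq
    _ = Real.sqrt (ε * A) * Real.exp (-(δ / 2 * t)) := Real.sqrt_sq hR

/-- Sup-norm of a kernel from the sup of its Fourier symbol (the shape of (4.35)): an average of unimodular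
coefficients against symbol values `≤ ε` in modulus is `≤ ε`. [folklore] -/
theorem abs_avg_le_of_symbol_le {ι : Type*} (P : Finset ι) (c Khat : ι → ℝ) {ε : ℝ} (hε : 0 ≤ ε)
    (hc : ∀ p ∈ P, |c p| ≤ 1) (hK : ∀ p ∈ P, |Khat p| ≤ ε) :
    |(P.card : ℝ)⁻¹ * ∑ p ∈ P, c p * Khat p| ≤ ε := by
  rcases P.eq_empty_or_nonempty with hP | hP
  · simp [hP, hε]
  have hcard : (0:ℝ) < P.card := by exact_mod_cast hP.card_pos
  rw [abs_mul, abs_inv, abs_of_pos hcard]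
  calc (P.card : ℝ)⁻¹ * |∑ p ∈ P, c p * Khat p|
      ≤ (P.card : ℝ)⁻¹ * ∑ p ∈ P, ε := by
        gcongr
        refine (Finset.abs_sum_le_sum_abs _ _).trans (Finset.sum_le_sum fun p hp => ?_)
        rw [abs_mul]
        calc |c p| * |Khat p| ≤ 1 * ε := mul_le_mul (hc p hp) (hK p hp) (abs_nonneg _) zero_le_one
          _ = ε := one_mul ε
    _ = ε := by
        rw [Finset.sum_const, nsmul_eq_mul, inv_mul_cancel_left₀ hcard.ne']

omit [Fintype n] [DecidableEq n] in
/-- Weakening a decay bound to a smaller rate (to bring all kernels to a common `κ`). [folklore] -/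
theorem exp_decay_mono {κ κ' t A : ℝ} (hA : 0 ≤ A) (hκ : κ' ≤ κ) (ht : 0 ≤ t) :
    A * Real.exp (-(κ * t)) ≤ A * Real.exp (-(κ' * t)) :=
  mul_le_mul_of_nonneg_left (Real.exp_le_exp.mpr (by nlinarith [mul_le_mul_of_nonneg_right hκ ht])) hA


omit [Fintype n] [DecidableEq n] in
/-- The rate input of `lemma45` produced King's way: a SUP-NORM rate `ε` for the kernel of `Δ^{(k+n)} − Δ^{(k)}`
(Lemma 4.3 via the Fourier representation (4.35), `abs_avg_le_of_symbol_le`) and decay `C₁e^{−2κd}` of each of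
`Δ^{(k)}`, `Δ^{(k+n)}` (Theorem 3.3) give `|Δ^{(k+n)}(z,w) − Δ^{(k)}(z,w)| ≤ √(2C₁ε) e^{−κ d(z,w)}`. [folklore] -/
theorem sub_kernel_rate (Δ₁ Δ₀ : Matrix n n ℝ) (d : n → n → ℝ) {ε C₁ κ : ℝ} (hε : 0 ≤ ε)
    (hEsup : ∀ z w, |(Δ₀ - Δ₁) z w| ≤ ε)
    (hD1 : ∀ z w, |Δ₁ z w| ≤ C₁ * Real.exp (-(2 * κ * d z w)))
    (hD0 : ∀ z w, |Δ₀ z w| ≤ C₁ * Real.exp (-(2 * κ * d z w))) (z w : n) :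
    |(Δ₀ - Δ₁) z w| ≤ Real.sqrt (ε * (2 * C₁)) * Real.exp (-(κ * d z w)) := by
  have hdec : |(Δ₀ - Δ₁) z w| ≤ (2 * C₁) * Real.exp (-(2 * κ * d z w)) := by
    rw [Matrix.sub_apply]
    calc |Δ₀ z w - Δ₁ z w| ≤ |Δ₀ z w| + |Δ₁ z w| := abs_sub _ _
      _ ≤ C₁ * Real.exp (-(2 * κ * d z w)) + C₁ * Real.exp (-(2 * κ * d z w)) := add_le_add (hD0 z w) (hD1 z w)
      _ = (2 * C₁) * Real.exp (-(2 * κ * d z w)) := by ring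
  have h := abs_le_sqrt_mul_exp_half hε (hEsup z w) hdec
  have e : 2 * κ / 2 * d z w = κ * d z w := by ring
  rwa [e] at h

end rate

/-! ## §8 Lemma 4.5 assembled -/

section lemma45

variable (Δ₁ Δ₀ B : Matrix n n ℝ)

/-- **King's Lemma 4.5 (4.38), finite-volume kernel form.**  Index set `n` (the unit lattice `Ω`) with a
pseudo-metric `d`; `Δ₁ = Δ^{(k)}`, `Δ₀ = Δ^{(k+n)}`, `B = aL⁻²Q*Q` real matrices with
(i) ENDPOINT COERCIVITY (4.33): `Δ^{(k)} + B ≥ γ₀`, `Δ^{(k+n)} + B ≥ γ₀` [King: Fourier bound (4.35)–(4.37), A = 0 —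
hypothesis here];
(ii) DECAY (4.34) in Combes–Thomas form: weighted off-diagonal row/column sums at weight `e^{κd} − 1` of `Δ^{(k)}`,
`Δ^{(k+n)}` (`≤ ρ`) and `B` (`≤ ρ_B`), `ρ + ρ_B < γ₀` [King: "Q*Q is a short-range operator and Δ^{(k)} has uniform
exponential decay (see Theorem 3.3)" = [Ba 4] — hypothesis here];
(iii) THE RATE INPUT in position space: `|Δ^{(k+n)}(z,w) − Δ^{(k)}(z,w)| ≤ θ e^{−κ d(z,w)}` [King: Lemma 4.3 + uniform
decay, `θ = CL^{−k}`, cf. `abs_le_sqrt_mul_exp_half` — hypothesis here];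
(iv) the volume-independent sum `Σ_z e^{−(κ/2)d(x,z)} ≤ V`.
THEN `|C^{(k)}(x,y) − C^{(k+n)}(x,y)| ≤ θ (γ₀ − ρ − ρ_B)⁻² V² e^{−(κ/2) d(x,y)}` — (4.38) with `CL^{−k} ↦ θ(γ₀−ρ−ρ_B)⁻²V²`
and `δ₀ ↦ κ/2`.  Proof = the endpoint resolvent identity + `covOp_decay` + `triple_decay_bound`; King's own route through
the `s`-integral (4.39) gives the same bound (`lemma45_via_integral`). [cite: King1986, Lemma 4.5 (4.38) p.674, proof pp.674–675] -/
theorem lemma45 (d : n → n → ℝ) {γ κ ρ ρB θ V : ℝ} (hγ : ρ + ρB < γ) (hκ : 0 ≤ κ) (hθ : 0 ≤ θ)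
    (h1 : Coercive (Δ₁ + B) γ) (h0 : Coercive (Δ₀ + B) γ)
    (hd_symm : ∀ i j, d i j = d j i) (hd_zero : ∀ i, d i i = 0)
    (hd_tri : ∀ i j k, d i k ≤ d i j + d j k)
    (hr1 : ∀ i, wRow Δ₁ d κ i ≤ ρ) (hr0 : ∀ i, wRow Δ₀ d κ i ≤ ρ) (hrB : ∀ i, wRow B d κ i ≤ ρB)
    (hc1 : ∀ j, wCol Δ₁ d κ j ≤ ρ) (hc0 : ∀ j, wCol Δ₀ d κ j ≤ ρ) (hcB : ∀ j, wCol B d κ j ≤ ρB)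
    (hE : ∀ z w, |(Δ₀ - Δ₁) z w| ≤ θ * Real.exp (-(κ * d z w)))
    (hV : ∀ x, ∑ z, Real.exp (-(κ / 2 * d x z)) ≤ V) (x y : n) :
    |(Δ₁ + B)⁻¹ x y - (Δ₀ + B)⁻¹ x y|
      ≤ θ * ((γ - (ρ + ρB))⁻¹) ^ 2 * V ^ 2 * Real.exp (-(κ / 2 * d x y)) := by
  have hd := pseudo_nonneg d hd_symm hd_zero hd_tri
  have hγρ : 0 < γ - (ρ + ρB) := sub_pos.mpr hγ
  -- `ρ, ρ_B ≥ 0` (the index set is nonempty since `x : n`), hence `γ > 0` and the endpoint operators are units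
  have hρ0 : 0 ≤ ρ := by
    refine le_trans (Finset.sum_nonneg fun j _ => mul_nonneg (abs_nonneg _) ?_) (hr1 x)
    have : 1 ≤ Real.exp (κ * d x j) := Real.one_le_exp (mul_nonneg hκ (hd x j))
    linarith
  have hρB0 : 0 ≤ ρB := by
    refine le_trans (Finset.sum_nonneg fun j _ => mul_nonneg (abs_nonneg _) ?_) (hrB x)
    have : 1 ≤ Real.exp (κ * d x j) := Real.one_le_exp (mul_nonneg hκ (hd x j))
    linarith
  have hγ0 : 0 < γ := by linarith
  have hU1 : IsUnit (Δ₁ + B) := isUnit_of_coercive hγ0 h1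
  have hU0 : IsUnit (Δ₀ + B) := isUnit_of_coercive hγ0 h0
  have e := covOp_one_sub_covOp_zero Δ₁ Δ₀ B hU1 hU0
  have e' : (Δ₁ + B)⁻¹ x y - (Δ₀ + B)⁻¹ x y = ((Δ₁ + B)⁻¹ * (Δ₀ - Δ₁) * (Δ₀ + B)⁻¹) x y := by
    have := congrArg (fun M : Matrix n n ℝ => M x y) e
    simpa [Matrix.sub_apply] using this
  rw [e']
  -- decay of the two endpoint covariances
  have hK1 : ∀ i j, |(Δ₁ + B)⁻¹ i j| ≤ (γ - (ρ + ρB))⁻¹ * Real.exp (-(κ * d i j)) := by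
    intro i j
    have := covOp_decay Δ₁ Δ₀ B d hγ hκ h1 h0 hd_symm hd_zero hd_tri hr1 hr0 hrB hc1 hc0 hcB
      zero_le_one le_rfl i j
    simpa [covOp_one] using this
  have hK0 : ∀ i j, |(Δ₀ + B)⁻¹ i j| ≤ (γ - (ρ + ρB))⁻¹ * Real.exp (-(κ * d i j)) := by
    intro i j
    have := covOp_decay Δ₁ Δ₀ B d hγ hκ h1 h0 hd_symm hd_zero hd_tri hr1 hr0 hrB hc1 hc0 hcB
      le_rfl zero_le_one i j
    simpa [covOp_zero] using this
  have := triple_decay_bound d hd hd_tri ((Δ₁ + B)⁻¹) (Δ₀ - Δ₁) ((Δ₀ + B)⁻¹) hκ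
    (inv_nonneg.mpr hγρ.le) hθ hK1 hE hK0 hV x y
  calc |((Δ₁ + B)⁻¹ * (Δ₀ - Δ₁) * (Δ₀ + B)⁻¹) x y|
      ≤ (γ - (ρ + ρB))⁻¹ * θ * (γ - (ρ + ρB))⁻¹ * V ^ 2 * Real.exp (-(κ / 2 * d x y)) := this
    _ = θ * ((γ - (ρ + ρB))⁻¹) ^ 2 * V ^ 2 * Real.exp (-(κ / 2 * d x y)) := by ring

/-- King's own route gives the same bound: every value of the integrand (4.40) on `[0,1]` obeys (4.41), hence so
does the `s`-integral (4.39). [cite: King1986, (4.39)–(4.41) pp.674–675] -/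
theorem lemma45_via_integral (d : n → n → ℝ) {γ κ ρ ρB θ V : ℝ} (hγ : ρ + ρB < γ) (hκ : 0 ≤ κ)
    (hθ : 0 ≤ θ)
    (h1 : Coercive (Δ₁ + B) γ) (h0 : Coercive (Δ₀ + B) γ)
    (hd_symm : ∀ i j, d i j = d j i) (hd_zero : ∀ i, d i i = 0)
    (hd_tri : ∀ i j k, d i k ≤ d i j + d j k)
    (hr1 : ∀ i, wRow Δ₁ d κ i ≤ ρ) (hr0 : ∀ i, wRow Δ₀ d κ i ≤ ρ) (hrB : ∀ i, wRow B d κ i ≤ ρB)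
    (hc1 : ∀ j, wCol Δ₁ d κ j ≤ ρ) (hc0 : ∀ j, wCol Δ₀ d κ j ≤ ρ) (hcB : ∀ j, wCol B d κ j ≤ ρB)
    (hE : ∀ z w, |(Δ₀ - Δ₁) z w| ≤ θ * Real.exp (-(κ * d z w)))
    (hV : ∀ x, ∑ z, Real.exp (-(κ / 2 * d x z)) ≤ V) (x y : n) :
    |∫ s in (0:ℝ)..1, dcovOp Δ₁ Δ₀ B s x y|
      ≤ θ * ((γ - (ρ + ρB))⁻¹) ^ 2 * V ^ 2 * Real.exp (-(κ / 2 * d x y)) := by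
  have hd := pseudo_nonneg d hd_symm hd_zero hd_tri
  have hγρ : 0 < γ - (ρ + ρB) := sub_pos.mpr hγ
  have hbound : ∀ s ∈ Set.uIoc (0:ℝ) 1, ‖dcovOp Δ₁ Δ₀ B s x y‖
      ≤ θ * ((γ - (ρ + ρB))⁻¹) ^ 2 * V ^ 2 * Real.exp (-(κ / 2 * d x y)) := by
    intro s hs
    rw [Set.uIoc_of_le zero_le_one] at hs
    have hK : ∀ i j, |covOp Δ₁ Δ₀ B s i j| ≤ (γ - (ρ + ρB))⁻¹ * Real.exp (-(κ * d i j)) := fun i j =>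
      covOp_decay Δ₁ Δ₀ B d hγ hκ h1 h0 hd_symm hd_zero hd_tri hr1 hr0 hrB hc1 hc0 hcB hs.1.le hs.2 i j
    rw [Real.norm_eq_abs]
    have := triple_decay_bound d hd hd_tri (covOp Δ₁ Δ₀ B s) (Δ₀ - Δ₁) (covOp Δ₁ Δ₀ B s) hκ
      (inv_nonneg.mpr hγρ.le) hθ hK hE hK hV x y
    calc |dcovOp Δ₁ Δ₀ B s x y|
        ≤ (γ - (ρ + ρB))⁻¹ * θ * (γ - (ρ + ρB))⁻¹ * V ^ 2 * Real.exp (-(κ / 2 * d x y)) := this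
      _ = θ * ((γ - (ρ + ρB))⁻¹) ^ 2 * V ^ 2 * Real.exp (-(κ / 2 * d x y)) := by ring
  have := intervalIntegral.norm_integral_le_of_norm_le_const hbound
  rw [Real.norm_eq_abs] at this
  simpa using this


/-- **Lemma 4.5 from King's own inputs for the rate**: as `lemma45`, but with the middle factor controlled the printed
way — a sup-norm rate `ε` (`= CL^{−2k}`, Lemma 4.3) and the decay `C₁e^{−2κd}` of `Δ^{(k)}`, `Δ^{(k+n)}` — giving the rate
`√(2C₁ε)` (`= C′L^{−k}`) in (4.38): *"Combining Lemma 4.3 and the uniform exponential decay of Δ^{(k)} and C_Ω^{(k)}(s)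
gives |(4.40)| ≤ CL^{−k} …"* [cite: King1986, (4.41) p.675] -/
theorem lemma45_of_supRate (d : n → n → ℝ) {γ κ ρ ρB ε C₁ V : ℝ} (hγ : ρ + ρB < γ) (hκ : 0 ≤ κ)
    (hε : 0 ≤ ε)
    (h1 : Coercive (Δ₁ + B) γ) (h0 : Coercive (Δ₀ + B) γ)
    (hd_symm : ∀ i j, d i j = d j i) (hd_zero : ∀ i, d i i = 0)
    (hd_tri : ∀ i j k, d i k ≤ d i j + d j k)
    (hr1 : ∀ i, wRow Δ₁ d κ i ≤ ρ) (hr0 : ∀ i, wRow Δ₀ d κ i ≤ ρ) (hrB : ∀ i, wRow B d κ i ≤ ρB)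
    (hc1 : ∀ j, wCol Δ₁ d κ j ≤ ρ) (hc0 : ∀ j, wCol Δ₀ d κ j ≤ ρ) (hcB : ∀ j, wCol B d κ j ≤ ρB)
    (hEsup : ∀ z w, |(Δ₀ - Δ₁) z w| ≤ ε)
    (hD1 : ∀ z w, |Δ₁ z w| ≤ C₁ * Real.exp (-(2 * κ * d z w)))
    (hD0 : ∀ z w, |Δ₀ z w| ≤ C₁ * Real.exp (-(2 * κ * d z w)))
    (hV : ∀ x, ∑ z, Real.exp (-(κ / 2 * d x z)) ≤ V) (x y : n) :
    |(Δ₁ + B)⁻¹ x y - (Δ₀ + B)⁻¹ x y|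
      ≤ Real.sqrt (ε * (2 * C₁)) * ((γ - (ρ + ρB))⁻¹) ^ 2 * V ^ 2 * Real.exp (-(κ / 2 * d x y)) :=
  lemma45 Δ₁ Δ₀ B d hγ hκ (Real.sqrt_nonneg _) h1 h0 hd_symm hd_zero hd_tri hr1 hr0 hrB hc1 hc0 hcB
    (sub_kernel_rate Δ₁ Δ₀ d hε hEsup hD1 hD0) hV x y

end lemma45

end Literature.MathematicalPhysics.QuantumFieldTheory.King1986

end
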